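import Mathlib.Algebra.Order.Group.PosPart
import Mathlib.Algebra.Order.Pi
import Mathlib.Algebra.Group.Submonoid.Finsupp
import Mathlib.GroupTheory.Finiteness
import Mathlib.LinearAlgebra.Span.Defs
import Mathlib.Data.Fintype.Pi
import Mathlib.Data.Int.Interval
import Mathlib.Algebra.Group.Pi.Lemmas
import Mathlib.Tactic.Ring
import Mathlib.Tactic.Linarith
import Mathlib.Tactic.Positivity
import HarnessLib

/-!
# The Kummer cone: the fs monoid of the normalised `p`-cyclic cover `τ^p = x_{j₀} ∏ x_j^{c_j}`

Topic: `Literature/AlgebraicGeometry/Resolution`. DEFINITION (with its basic API, all proved) of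
the finitely generated, saturated, spanning submonoid `P ⊆ ℤʳ` which charts the normalisation of
the purely inseparable Kummer cover `τ^p = x_{j₀} · ∏_{j ≠ j₀} x_j^{c_j}` of a regular local
ring with regular parameters `x_1, …, x_r` (K. Kato, *Toric singularities*, Amer. J. Math. 116
(1994), Def. (2.1) and the example (2.2)(2)/(1.7): the toric directions of an snc pair; the
monoid is the one of the affine toric variety of the lattice `L = ℤʳ + ℤ · c/p`,
`P = {m ∈ L | m ≥ 0}`, written in the basis `c/p, (e_j)_{j ≠ j₀}` of `L` when `c_{j₀} = 1`).

In the coordinates `v : Fin r → ℤ` of that basis the lattice point is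
`m(v) = v_{j₀} · c/p + ∑_{j ≠ j₀} v_j e_j`, so `p · m(v)` is the integer vector
`kummerExp p j₀ c v = (v_{j₀} ; c_j v_{j₀} + p v_j)_{j ≠ j₀}` (for `c_{j₀} = 1`), and

  `kummerCone p j₀ c = {v | ∀ j, 0 ≤ kummerExp p j₀ c v j}`
                    `= {v | 0 ≤ v_{j₀} ∧ ∀ j ≠ j₀, 0 ≤ c_j v_{j₀} + p v_j}`.

The chart of the cover sends `v ↦ τ^{v_{j₀}} ∏_{j ≠ j₀} x_j^{v_j}`, whose `p`-th power is the
genuine monomial `x^{kummerExp v}`; this file only treats the monoid.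

* `kummerExp`, `kummerCone` — the definitions; `mem_kummerCone_iff`, `mem_kummerCone_iff'`;
* `kummerCone_saturated` — `k • v ∈ P`, `0 < k` ⇒ `v ∈ P` (Kato (1.1));
* `mem_kummerCone_of_nonneg` — `ℕʳ ⊆ P`; `span_kummerCone_eq_top` — `P` spans `ℤʳ`;
* `pivotGen_mem_kummerCone` — the relation vector `(p ; -c_j) ∈ P` (the monomial `x_{j₀}`);
* `kummerCone_fg` — `P` is finitely generated (by the unit vectors, `(p ; -c_j)` and the
  finitely many elements of `P` in the box `0 ≤ v_{j₀} < p`, `-c_j ≤ v_j ≤ 0`);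
* `kummerExp_injective` — `v ↦ p · m(v)` is injective (`0 < p`).

What is NOT here: the toric algebra `𝒪 ⊗_{ℤ[ℕʳ]} ℤ[P]` and its log regularity (Kato (2.1) for
this chart), the identification `P ≅ {m ∈ ℤʳ + ℤ c/p | m ≥ 0}`.

Sources: [Kato1994] K. Kato, *Toric singularities*, Amer. J. Math. 116 (1994) 1073–1099, (1.1),
(1.5), Def. (2.1), (2.2)(2). [Giraud1983] J. Giraud, *Forme normale d'une fonction sur une
surface de caractéristique positive*, Bull. SMF 111 (1983), Prop. 1.5 (the Kummer form
`a = g^p + x^A u`).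
-/

namespace Literature.AlgebraicGeometry.Resolution

variable {r : ℕ}

/-- **`p` times the lattice point of the coordinate vector `v`**: for the lattice
`L = ℤʳ + ℤ·c/p` (`c_{j₀} = 1`) with basis `c/p, (e_j)_{j ≠ j₀}`, the vector `v` names
`m(v) = v_{j₀} c/p + ∑_{j ≠ j₀} v_j e_j` and `kummerExp p j₀ c v = p·m(v)`, i.e.
`j₀ ↦ v j₀` and `j ↦ c j * v j₀ + p * v j` for `j ≠ j₀` — the exponent of the honest monomial
`(τ^{v_{j₀}} ∏_{j≠j₀} x_j^{v_j})^p = x^{kummerExp v}`. [cite: Kato1994, Def. (2.1) and (2.2)(2)] -/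
def kummerExp (p : ℕ) (j₀ : Fin r) (c : Fin r → ℕ) : (Fin r → ℤ) →+ (Fin r → ℤ) where
  toFun v j := if j = j₀ then v j₀ else (c j : ℤ) * v j₀ + (p : ℤ) * v j
  map_zero' := by
    ext j
    simp
  map_add' v w := by
    ext j
    simp only [Pi.add_apply]
    split_ifs <;> ring

/-- Value at the pivot index. [folklore] -/
@[simp] theorem kummerExp_apply_self (p : ℕ) (j₀ : Fin r) (c : Fin r → ℕ) (v : Fin r → ℤ) :
    kummerExp p j₀ c v j₀ = v j₀ := by
  simp [kummerExp]

/-- Value off the pivot index. [folklore] -/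
theorem kummerExp_apply_of_ne (p : ℕ) {j₀ j : Fin r} (c : Fin r → ℕ) (v : Fin r → ℤ)
    (h : j ≠ j₀) : kummerExp p j₀ c v j = (c j : ℤ) * v j₀ + (p : ℤ) * v j := by
  simp [kummerExp, h]

/-- `kummerExp` is injective when `0 < p`. [folklore] -/
theorem kummerExp_injective {p : ℕ} (hp : 0 < p) (j₀ : Fin r) (c : Fin r → ℕ) :
    Function.Injective (kummerExp p j₀ c) := by
  intro v w h
  have h0 : v j₀ = w j₀ := by
    have := congrFun h j₀
    simpa using this
  ext j
  by_cases hj : j = j₀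
  · rw [hj, h0]
  · have := congrFun h j
    rw [kummerExp_apply_of_ne p c v hj, kummerExp_apply_of_ne p c w hj, h0] at this
    have hp' : (p : ℤ) ≠ 0 := by exact_mod_cast hp.ne'
    exact mul_left_cancel₀ hp' (add_left_cancel this)

/-- The **Kummer cone** `P = {v ∈ ℤʳ | p·m(v) ≥ 0}`: the fs monoid of non-negative points of the
lattice `ℤʳ + ℤ·c/p` in the coordinates of the basis `c/p, (e_j)_{j ≠ j₀}` (`c_{j₀} = 1`); the
chart monoid of the normalised Kummer cover `τ^p = x_{j₀} ∏_{j ≠ j₀} x_j^{c_j}` along an snc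
boundary. [cite: Kato1994, Def. (2.1) and (2.2)(2)] -/
def kummerCone (p : ℕ) (j₀ : Fin r) (c : Fin r → ℕ) : AddSubmonoid (Fin r → ℤ) where
  carrier := {v | ∀ j, 0 ≤ kummerExp p j₀ c v j}
  zero_mem' j := by simp
  add_mem' {v w} hv hw j := by
    rw [map_add, Pi.add_apply]
    exact add_nonneg (hv j) (hw j)

/-- Membership in the Kummer cone (`rfl`). [folklore] -/
theorem mem_kummerCone_iff {p : ℕ} {j₀ : Fin r} {c : Fin r → ℕ} {v : Fin r → ℤ} :
    v ∈ kummerCone p j₀ c ↔ ∀ j, 0 ≤ kummerExp p j₀ c v j :=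
  Iff.rfl

/-- Membership in the Kummer cone, in coordinates: `0 ≤ v_{j₀}` and `0 ≤ c_j v_{j₀} + p v_j`
for `j ≠ j₀`. [folklore] -/
theorem mem_kummerCone_iff' {p : ℕ} {j₀ : Fin r} {c : Fin r → ℕ} {v : Fin r → ℤ} :
    v ∈ kummerCone p j₀ c ↔ 0 ≤ v j₀ ∧ ∀ j, j ≠ j₀ → 0 ≤ (c j : ℤ) * v j₀ + (p : ℤ) * v j := by
  rw [mem_kummerCone_iff]
  constructor
  · intro h
    refine ⟨by simpa using h j₀, fun j hj => ?_⟩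
    rw [← kummerExp_apply_of_ne p c v hj]
    exact h j
  · rintro ⟨h0, h⟩ j
    by_cases hj : j = j₀
    · rw [hj, kummerExp_apply_self]
      exact h0
    · rw [kummerExp_apply_of_ne p c v hj]
      exact h j hj

/-- The pivot coordinate of an element of the cone is non-negative. [folklore] -/
theorem apply_self_nonneg_of_mem_kummerCone {p : ℕ} {j₀ : Fin r} {c : Fin r → ℕ} {v : Fin r → ℤ}
    (hv : v ∈ kummerCone p j₀ c) : 0 ≤ v j₀ :=
  (mem_kummerCone_iff'.mp hv).1

/-- **Saturation** (Kato (1.1)): if a positive multiple of `v` lies in the cone, so does `v`.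
[cite: Kato1994, (1.1)] -/
theorem kummerCone_saturated (p : ℕ) (j₀ : Fin r) (c : Fin r → ℕ) (v : Fin r → ℤ) (k : ℕ)
    (hk : 0 < k) (hv : k • v ∈ kummerCone p j₀ c) : v ∈ kummerCone p j₀ c := by
  intro j
  have h := hv j
  rw [map_nsmul, Pi.smul_apply, nsmul_eq_mul] at h
  have hk' : (0 : ℤ) < k := by exact_mod_cast hk
  rcases le_or_gt 0 (kummerExp p j₀ c v j) with hle | hlt
  · exact hle
  · exact absurd h (not_le.mpr (by nlinarith))

/-- **The cone contains the positive orthant** `ℕʳ` (the monomials `τ^{v_{j₀}} ∏ x_j^{v_j}` with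
non-negative exponents). [cite: Kato1994, (2.2)(2)] -/
theorem mem_kummerCone_of_nonneg {p : ℕ} {j₀ : Fin r} {c : Fin r → ℕ} {v : Fin r → ℤ}
    (hv : ∀ j, 0 ≤ v j) : v ∈ kummerCone p j₀ c := by
  refine mem_kummerCone_iff'.mpr ⟨hv j₀, fun j _ => ?_⟩
  have h1 : 0 ≤ (c j : ℤ) * v j₀ := mul_nonneg (by positivity) (hv j₀)
  have h2 : 0 ≤ (p : ℤ) * v j := mul_nonneg (by positivity) (hv j)
  exact add_nonneg h1 h2

/-- The unit vectors lie in the cone. [folklore] -/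
theorem single_mem_kummerCone (p : ℕ) (j₀ : Fin r) (c : Fin r → ℕ) (j : Fin r) (n : ℕ) :
    Pi.single j (n : ℤ) ∈ kummerCone p j₀ c := by
  refine mem_kummerCone_of_nonneg fun i => ?_
  by_cases h : i = j
  · subst h
    simp
  · simp [h]

/-- **The cone spans `ℤʳ`** (it contains `ℕʳ`, and `v = v⁺ - v⁻`). [cite: Kato1994, (1.5)] -/
theorem span_kummerCone_eq_top (p : ℕ) (j₀ : Fin r) (c : Fin r → ℕ) :
    Submodule.span ℤ (kummerCone p j₀ c : Set (Fin r → ℤ)) = ⊤ := by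
  refine top_le_iff.mp fun v _ => ?_
  rw [← posPart_sub_negPart v]
  refine Submodule.sub_mem _ (Submodule.subset_span ?_) (Submodule.subset_span ?_)
  · exact mem_kummerCone_of_nonneg fun j => posPart_nonneg v j
  · exact mem_kummerCone_of_nonneg fun j => negPart_nonneg v j

/-- The **relation vector** `pivotGen = (p ; -c_j)_{j ≠ j₀}` — the coordinates of the monomial
`x_{j₀} = τ^p / ∏_{j ≠ j₀} x_j^{c_j}`. [cite: Kato1994, (2.2)(2)] -/
def pivotGen (p : ℕ) (j₀ : Fin r) (c : Fin r → ℕ) : Fin r → ℤ :=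
  fun j => if j = j₀ then (p : ℤ) else -(c j : ℤ)

/-- `kummerExp` of the relation vector is `p · e_{j₀}`. [folklore] -/
theorem kummerExp_pivotGen (p : ℕ) (j₀ : Fin r) (c : Fin r → ℕ) :
    kummerExp p j₀ c (pivotGen p j₀ c) = Pi.single j₀ (p : ℤ) := by
  ext j
  by_cases hj : j = j₀
  · subst hj
    simp [pivotGen]
  · rw [kummerExp_apply_of_ne p c _ hj]
    simp [pivotGen, hj, mul_comm]

/-- The relation vector lies in the cone. [folklore] -/
theorem pivotGen_mem_kummerCone (p : ℕ) (j₀ : Fin r) (c : Fin r → ℕ) :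
    pivotGen p j₀ c ∈ kummerCone p j₀ c := by
  intro j
  rw [kummerExp_pivotGen]
  by_cases hj : j = j₀
  · subst hj; simp
  · simp [hj]

/-- A vector with non-negative entries lies in the additive closure of the unit vectors.
[folklore] -/
theorem mem_closure_single_of_nonneg {v : Fin r → ℤ} (hv : ∀ j, 0 ≤ v j) :
    v ∈ AddSubmonoid.closure (Set.range fun j : Fin r => Pi.single j (1 : ℤ)) := by
  have hrepr : v = ∑ j, (v j).toNat • Pi.single j (1 : ℤ) := by
    ext i
    simp only [Finset.sum_apply, nsmul_eq_mul]
    rw [Finset.sum_eq_single i]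
    · simp [Int.toNat_of_nonneg (hv i)]
    · intro j _ hji
      simp [Pi.single_eq_of_ne (Ne.symm hji)]
    · intro h
      exact absurd (Finset.mem_univ i) h
  rw [hrepr]
  refine AddSubmonoid.sum_mem _ fun j _ => nsmul_mem ?_ _
  exact AddSubmonoid.subset_closure ⟨j, rfl⟩

/-- The finite **box** of coordinate vectors `0 ≤ v_{j₀} ≤ p`, `-c_j ≤ v_j ≤ 0` (`j ≠ j₀`)
containing, together with the unit vectors and `pivotGen`, a generating set of the cone.
[folklore] -/
def kummerBox (p : ℕ) (c : Fin r → ℕ) : Set (Fin r → ℤ) :=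
  {v | ∀ j, v j ∈ Set.Icc (-(c j : ℤ) - p) p}

/-- The box is finite. [folklore] -/
theorem kummerBox_finite (p : ℕ) (c : Fin r → ℕ) : (kummerBox p c).Finite :=
  Set.Finite.pi' fun _ => Set.finite_Icc _ _

/-- **Reduction to the box**: every `v ∈ P` is `q • pivotGen + f + w` with `q ∈ ℕ`, `f ∈ P` in
the box and `w ∈ ℕʳ`. [folklore] -/
theorem exists_decomp_of_mem_kummerCone {p : ℕ} (hp : 0 < p) {j₀ : Fin r} {c : Fin r → ℕ}
    {v : Fin r → ℤ} (hv : v ∈ kummerCone p j₀ c) :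
    ∃ (q : ℕ) (f w : Fin r → ℤ), f ∈ kummerCone p j₀ c ∧ f ∈ kummerBox p c ∧
      (∀ j, 0 ≤ w j) ∧ v = q • pivotGen p j₀ c + f + w := by
  obtain ⟨h0, h⟩ := mem_kummerCone_iff'.mp hv
  have hp' : (0 : ℤ) < p := by exact_mod_cast hp
  -- Euclidean division of the pivot coordinate
  set q : ℤ := v j₀ / p with hq
  set i : ℤ := v j₀ % p with hi
  have hi0 : 0 ≤ i := Int.emod_nonneg _ hp'.ne'
  have hip : i < p := Int.emod_lt_of_pos _ hp'
  have hdiv : v j₀ = i + p * q := by rw [hi, hq, Int.emod_add_mul_ediv]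
  have hq0 : 0 ≤ q := Int.ediv_nonneg h0 hp'.le
  have key : ∀ j, j ≠ j₀ → 0 ≤ (c j : ℤ) * i + (p : ℤ) * (v j + q * c j) := by
    intro j hj
    have := h j hj
    rw [hdiv] at this
    linarith
  -- `f` keeps the remainder `i` at the pivot and the negative parts elsewhere; `w` the rest
  refine ⟨q.toNat, fun j => if j = j₀ then i else min (v j + q * c j) 0,
    fun j => if j = j₀ then 0 else max (v j + q * c j) 0, ?_, ?_, ?_, ?_⟩
  · -- `f ∈ P`
    refine mem_kummerCone_iff'.mpr ⟨by simp [hi0], fun j hj => ?_⟩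
    simp only [if_true, if_neg hj]
    rcases le_total (v j + q * c j) 0 with hle | hle
    · rw [min_eq_left hle]
      exact key j hj
    · rw [min_eq_right hle, mul_zero, add_zero]
      positivity
  · -- `f` lies in the box
    intro j
    simp only [Set.mem_Icc]
    by_cases hj : j = j₀
    · subst hj
      simp only [if_true]
      have hc : (0 : ℤ) ≤ c j := by positivity
      constructor
      · linarith
      · exact hip.le
    · simp only [if_neg hj]
      have hc : (0 : ℤ) ≤ c j := by positivity
      constructor
      · rcases le_total (v j + q * c j) 0 with hle | hle
        · rw [min_eq_left hle]
          have h1 : (c j : ℤ) * i ≤ c j * p := mul_le_mul_of_nonneg_left hip.le hc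
          have h2 : (p : ℤ) * (-(c j : ℤ)) ≤ (p : ℤ) * (v j + q * c j) := by
            have := key j hj
            linarith
          have h3 : -(c j : ℤ) ≤ v j + q * c j := le_of_mul_le_mul_left h2 hp'
          linarith
        · rw [min_eq_right hle]
          linarith
      · exact (min_le_right _ _).trans hp'.le
  · intro j
    by_cases hj : j = j₀
    · simp [hj]
    · simp only [if_neg hj]
      exact le_max_right _ _
  · have htn : ((q.toNat : ℕ) : ℤ) = q := Int.toNat_of_nonneg hq0
    ext j
    rw [Pi.add_apply, Pi.add_apply, Pi.smul_apply, nsmul_eq_mul, htn]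
    by_cases hj : j = j₀
    · subst hj
      simp only [pivotGen, if_true, hdiv]
      ring
    · simp only [pivotGen, if_neg hj]
      rw [add_assoc, min_add_max]
      ring

/-- **The Kummer cone is finitely generated** (an fs monoid): by the unit vectors, the relation
vector `pivotGen` and the finitely many cone elements in the box. [cite: Kato1994, (1.5)] -/
theorem kummerCone_fg {p : ℕ} (hp : 0 < p) (j₀ : Fin r) (c : Fin r → ℕ) :
    (kummerCone p j₀ c).FG := by
  rw [AddSubmonoid.fg_iff]
  let T : Set (Fin r → ℤ) := Set.range (fun j : Fin r => Pi.single j (1 : ℤ)) ∪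
    {pivotGen p j₀ c} ∪ ((kummerCone p j₀ c : Set (Fin r → ℤ)) ∩ kummerBox p c)
  have hT1 : Set.range (fun j : Fin r => Pi.single j (1 : ℤ)) ⊆ T :=
    Set.subset_union_left.trans Set.subset_union_left
  have hT2 : pivotGen p j₀ c ∈ AddSubmonoid.closure T :=
    AddSubmonoid.subset_closure (Or.inl (Or.inr rfl))
  refine ⟨T, ?_, ?_⟩
  · apply le_antisymm
    · rw [AddSubmonoid.closure_le]
      rintro v ((⟨j, rfl⟩ | rfl) | ⟨hv, -⟩)
      · exact_mod_cast single_mem_kummerCone p j₀ c j 1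
      · exact pivotGen_mem_kummerCone p j₀ c
      · exact hv
    · intro v hv
      obtain ⟨q, f, w, hf, hfb, hw, rfl⟩ := exists_decomp_of_mem_kummerCone hp hv
      refine AddSubmonoid.add_mem _ (AddSubmonoid.add_mem _ ?_ ?_) ?_
      · exact AddSubmonoid.nsmul_mem _ hT2 q
      · exact AddSubmonoid.subset_closure (Or.inr ⟨hf, hfb⟩)
      · exact AddSubmonoid.closure_mono hT1 (mem_closure_single_of_nonneg hw)
  · exact ((Set.finite_range _).union (Set.finite_singleton _)).union
      ((kummerBox_finite p c).subset Set.inter_subset_right)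

end Literature.AlgebraicGeometry.Resolution
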